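import Mathlib
import Summits.NavierStokesRegularity.NavierStokesRegularity.Theorems.EulerZoomLiouvillePowerGaugeEulerLiouvilleSelfSimilarSwirlCasimir
import HarnessLib

/-!
# Crux E `PowerGaugeEulerLiouville` (stmt-NavierStokesRegularity-19832), THE ONE STATEMENT: THE SWIRL RATCHET, V — THE FAT TAIL: the backward half of the volume law,
# the power-law LOWER bound on the swirl distribution of a swirling axisymmetric `C²` needle, and the heavy-side Casimir kill `p > 3/ρ` (width seat ns-ezl-w3 g3)

Route №10 `EulerZoomLiouville` (NavierStokesRegularity), crux E; LEAD ns-typeII-p2 g12.  Sequel of `…SelfSimilarSwirlVolumeLaw` (forward half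
`e^{3γs}·vol{|Γ|>μ} ≤ vol{|Γ|>μe^{−(1−2γ)s}}`) and `…SelfSimilarSwirlCasimir` (`p < 3/ρ`).  Here the BACKWARD half: pull a bounded piece of the LOW superlevel set
`{|Γ| > μe^{−(1−2γ)s}} ∩ B_n` back by `Φ_s` (preimage `C`, orbits bounded by Grönwall on the backward field, `norm_flow_neg_le_gronwallBound`); `Φ_s C` is that piece, of volume
`e^{3γs}·vol C` (the LEAD's (C1) tool on the cut-off flow), and the forward ratchet puts `C` inside `{|Γ| > μ}`:

* `SwirlRatchet.volume_superlevel_ratchet_backward` — `vol{|Γ| > μe^{−(1−2γ)s}} ≤ e^{3γs}·vol{|Γ| > μ}` (`s ≥ 0`, any `γ > 0`; axisymmetric `C²` profile of CIV (3.3) of linear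
  growth).  With the forward half: the swirl distribution `m(μ) = vol{|Γ|>μ}` transforms EXACTLY, `m(μe^{−(1−2γ)s}) = e^{3γs}m(μ)` — in the class (`1−2γ = ργ`,
  `γ = 1/(2+ρ)`) the pure power law `m(λμ) = λ^{−3/ρ} m(μ)` for every `λ > 0` (unless `m ≡ ∞`).
* `SwirlRatchet.swirl_fat_tail` — **THE FAT TAIL**: `vol{|Γ| > μ} ≤ e^{3γs}·vol{|Γ| > μe^{(1−2γ)s}}`: a swirling needle (`Γ(y₀) ≠ 0`, so `vol{|Γ| > |Γ(y₀)|/2} > 0`) has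
  `vol{|Γ| > λμ₀} ≥ λ^{−3/ρ}·vol{|Γ| > μ₀} > 0` for every `λ ≥ 1` — swirl above EVERY level on positive volume, with a power tail of exponent exactly `3/ρ` (≥ 6).
* `SwirlRatchet.hasNoSwirl_of_swirl_Lp_large` — **HEAVY-SIDE CASIMIR KILL**: `∫⁻|Γ|^p < ∞` with `3γ < p(1−2γ)` (class: `p > 3/ρ`) ⇒ swirl-free (Chebyshev `vol{|Γ|>μ} ≤ μ^{−p}∫|Γ|^p`
  decays faster than the fat tail allows).  With `…SwirlCasimir` (`p < 3/ρ`): **every finite swirl Casimir with exponent `p ≠ 3/ρ` kills** — `hasNoSwirl_of_swirl_Lp_ne`;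
  the balanced exponent `p = 3/ρ` (= the tree's `2kρ ≠ 3` exception of `AxisymSelfSimilarProfile`, here WITHOUT bounded `V`, `∇V`) is the only one left.
* MEMBER FORM `SwirlRatchet.selfSimilar_ae_eq_zero_of_axisym_swirlCasimir_C2` — crux binders + exactly self-similar ansatz + `ContDiff ℝ 2 V` + `IsAxisymmetric V` + linear growth +
  `∃ q, 0 < q ∧ q ≠ 3/ρ ∧ ∫⁻ ofReal(|swirl V|^q) < ⊤` ⇒ `u = 0` a.e.

WHAT THIS IS NOT: not NS regularity, not the crux E — strata / portrait of the crux CLASS 19832 (MODEL lattice; E/NS strata) `--supports` stmt-19832; the swirling axisymmetric `C²`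
needle with swirl distribution EXACTLY `∝ μ^{−3/ρ}` (no finite Casimir off the balanced exponent) stays OPEN.  [cite: Chae2007CMPEuler, Thm 2.1–2.2 + Note added p. 6;
ConstantinIgnatovaVicol2026Putative, §3.4.1 (3.21)–(3.22)]
-/

noncomputable section

-- flat `Theorems/<Route><Decl>…` files of one crux share the namespace of the crux (tree convention: `Summit.<S>.<S>.…`)
set_option linter.dupNamespace false

open MeasureTheory Set Filter Topology Metric Function InnerProductSpace
open scoped RealInnerProductSpace NNReal ContDiff

namespace Summit.NavierStokesRegularity.NavierStokesRegularity.Theorems.PowerGaugeEulerLiouville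

open Literature.Analysis Literature.Analysis.FluidPDE Literature.Analysis.FunctionSpaces
open Summit.NavierStokesRegularity.NavierStokesRegularity.Theorems.PowerGaugeEulerLiouville.BernoulliLandscape

namespace SwirlRatchet

variable {γ : ℝ} {U V : EuclideanSpace ℝ (Fin 3) → EuclideanSpace ℝ (Fin 3)} {P : EuclideanSpace ℝ (Fin 3) → ℝ}

/-! ### Backward orbits from a ball stay in a ball -/

/-- **Backward orbits of the similarity flow of a field of linear growth grow at most like Grönwall's bound**: `V ∈ C¹`, `‖DV‖ ≤ K`, `‖V y‖ ≤ K₁(1+‖y‖)`, `γ ≥ 0` ⇒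
`‖Φ_{−σ} y‖ ≤ gronwallBound ‖y‖ (γ+K₁) K₁ σ` for `σ ≥ 0` (the backward field `−W` has the same growth). [folklore] -/
theorem norm_flow_neg_le_gronwallBound (hV1 : ContDiff ℝ 1 V) {K : ℝ} (hK : ∀ y, ‖fderiv ℝ V y‖ ≤ K)
    {K₁ : ℝ} (hlin : ∀ y, ‖V y‖ ≤ K₁ * (1 + ‖y‖)) (hγ : 0 ≤ γ) (y : EuclideanSpace ℝ (Fin 3)) {σ : ℝ} (hσ : 0 ≤ σ) :
    ‖ODE.evolutionMap (fun _ : ℝ => selfSimilarTransport γ 0 V) 0 (-σ) y‖ ≤ gronwallBound ‖y‖ (γ + K₁) K₁ σ := by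
  set f : ℝ → EuclideanSpace ℝ (Fin 3) := fun r => ODE.evolutionMap (fun _ : ℝ => selfSimilarTransport γ 0 V) 0 (-r) y with hf
  have hder : ∀ r, HasDerivAt f ((-1 : ℝ) • selfSimilarTransport γ 0 V (f r)) r := fun r => C2.Kelvin.hasDerivAt_flow_neg (γ := γ) hV1 hK y r
  have hcont : ContinuousOn f (Icc 0 σ) := fun r _ => (hder r).continuousAt.continuousWithinAt
  have hf0 : ‖f 0‖ ≤ ‖y‖ := by simp [hf, ODE.evolutionMap_self]
  have hbound : ∀ r ∈ Ico 0 σ, ‖(-1 : ℝ) • selfSimilarTransport γ 0 V (f r)‖ ≤ (γ + K₁) * ‖f r‖ + K₁ := by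
    intro r _
    rw [norm_smul, norm_neg, norm_one, one_mul, selfSimilarTransport_apply, sub_zero]
    calc ‖γ • f r + V (f r)‖ ≤ ‖γ • f r‖ + ‖V (f r)‖ := norm_add_le _ _
      _ ≤ γ * ‖f r‖ + K₁ * (1 + ‖f r‖) := by rw [norm_smul, Real.norm_of_nonneg hγ]; exact add_le_add le_rfl (hlin _)
      _ = (γ + K₁) * ‖f r‖ + K₁ := by ring
  have h := norm_le_gronwallBound_of_norm_deriv_right_le hcont (fun r _ => (hder r).hasDerivWithinAt) hf0 hbound σ
    (right_mem_Icc.2 hσ)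
  rwa [sub_zero] at h

/-! ### The backward half of the volume law -/

/-- **THE VOLUME LAW OF THE SWIRL DISTRIBUTION (backward half).**  `(U, P)` a `C²` self-similar Euler profile (CIV (3.3)), `γ > 0`, `U` axisymmetric of linear growth,
`Γ = swirl U`.  For every level `μ` and every `s ≥ 0`: `vol{y | μe^{−(1−2γ)s} < |Γ y|} ≤ e^{3γs} · vol{y | μ < |Γ y|}`.
(For `B = {|Γ| > μe^{−(1−2γ)s}} ∩ B_n` and the cut-off flow `Φ`: `C = Φ_s⁻¹ B` has `Φ_s C = B`, its forward orbits are the backward orbits of `B` — bounded by Grönwall — so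
`vol B = e^{3γs}·vol C`, and the forward ratchet `|Γ(z)| = e^{(1−2γ)s}|Γ(Φ_s z)| > μ` puts `C ⊆ {|Γ| > μ}`; let `n → ∞`.) [cite: Chae2007CMPEuler, Thm 2.2 + Note added p. 6] -/
theorem volume_superlevel_ratchet_backward (h : IsSelfSimilarEulerProfile γ 0 U P) (hU : IsAxisymmetric U) (hγ : 0 < γ)
    {K₁ : ℝ} (hlin : ∀ y, ‖U y‖ ≤ K₁ * (1 + ‖y‖)) (μ : ℝ) {s : ℝ} (hs : 0 ≤ s) :
    volume {y : EuclideanSpace ℝ (Fin 3) | μ * Real.exp (-((1 - 2 * γ) * s)) < |swirl U y|} ≤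
      ENNReal.ofReal (Real.exp (3 * γ * s)) * volume {y : EuclideanSpace ℝ (Fin 3) | μ < |swirl U y|} := by
  have hK₁ : 0 ≤ K₁ := by
    have h0 := hlin 0
    rw [norm_zero, add_zero, mul_one] at h0
    exact (norm_nonneg _).trans h0
  have hΓc : Continuous (swirl U) := (contDiff_swirl h.contDiff_velocity).continuous
  set S : Set (EuclideanSpace ℝ (Fin 3)) := {y | μ < |swirl U y|} with hS
  set S' : Set (EuclideanSpace ℝ (Fin 3)) := {y | μ * Real.exp (-((1 - 2 * γ) * s)) < |swirl U y|} with hS'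
  have hS'o : IsOpen S' := isOpen_lt continuous_const (continuous_abs.comp hΓc)
  -- exhaust `S'` by balls
  have hmono : Monotone fun n : ℕ => S' ∩ ball (0 : EuclideanSpace ℝ (Fin 3)) n :=
    fun a b hab => inter_subset_inter_right _ (ball_subset_ball (by exact_mod_cast hab))
  have hUnion : (⋃ n : ℕ, S' ∩ ball (0 : EuclideanSpace ℝ (Fin 3)) n) = S' := by
    ext y
    simp only [mem_iUnion, mem_inter_iff, mem_ball_zero_iff]
    constructor
    · rintro ⟨n, hy, -⟩; exact hy
    · intro hy; obtain ⟨n, hn⟩ := exists_nat_gt ‖y‖; exact ⟨n, hy, hn⟩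
  have hsup : volume S' = ⨆ n : ℕ, volume (S' ∩ ball (0 : EuclideanSpace ℝ (Fin 3)) n) := by
    rw [← hmono.measure_iUnion, hUnion]
  rw [hsup]
  refine iSup_le fun n => ?_
  -- ### one ball: `B = S' ∩ B_n`
  set B : Set (EuclideanSpace ℝ (Fin 3)) := S' ∩ ball (0 : EuclideanSpace ℝ (Fin 3)) n with hB
  have hBm : MeasurableSet B := hS'o.measurableSet.inter measurableSet_ball
  set L : ℝ := γ + K₁ with hL
  have hL0 : 0 < L := by rw [hL]; linarith
  set Rstar : ℝ := gronwallBound (n : ℝ) L K₁ s with hRstar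
  set Rbig : ℝ := Rstar + 2 with hRbig
  have hRstar0 : 0 ≤ Rstar := by
    rw [hRstar, gronwallBound_of_K_ne_0 hL0.ne']
    have h1 : 1 ≤ Real.exp (L * s) := Real.one_le_exp (by positivity)
    have h2 : 0 ≤ K₁ / L := div_nonneg hK₁ hL0.le
    positivity
  have hRbig0 : 0 < Rbig := by rw [hRbig]; linarith
  obtain ⟨V, hV2, -, hsmul, ⟨K, hK⟩, hVU⟩ := Loc.exists_cutoff_local_smul h.contDiff_velocity hRbig0
  have hV1 : ContDiff ℝ 1 V := hV2.of_le (by norm_num)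
  have hVlin : ∀ y, ‖V y‖ ≤ K₁ * (1 + ‖y‖) := by
    intro y
    obtain ⟨c, hc0, hc1, hcy⟩ := hsmul y
    rw [hcy, norm_smul, Real.norm_of_nonneg hc0]
    exact (mul_le_of_le_one_left (norm_nonneg _) hc1).trans (hlin y)
  set Φ : ℝ → EuclideanSpace ℝ (Fin 3) → EuclideanSpace ℝ (Fin 3) :=
    ODE.evolutionMap (fun _ : ℝ => selfSimilarTransport γ 0 V) 0 with hΦ
  have hflow_add : ∀ (a b : ℝ) (y : EuclideanSpace ℝ (Fin 3)), Φ (a + b) y = Φ a (Φ b y) :=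
    fun a b y => C2.Kelvin.flow_add (γ := γ) hV1 hK a b y
  have hΦinv : ∀ y, Φ s (Φ (-s) y) = y := by
    intro y
    have h1 := hflow_add s (-s) y
    rw [add_neg_cancel] at h1
    rw [← h1]; exact ODE.evolutionMap_self _ 0 y
  have hWU : ∀ z : EuclideanSpace ℝ (Fin 3), ‖z‖ < Rbig → selfSimilarTransport γ 0 V z = selfSimilarTransport γ 0 U z := by
    intro z hz
    simp only [selfSimilarTransport_apply, hVU z (mem_ball_zero_iff.2 hz)]
  -- the pulled-back piece `C = Φ_s⁻¹ B`
  set C : Set (EuclideanSpace ℝ (Fin 3)) := Φ s ⁻¹' B with hC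
  have hΦsc : Continuous (Φ s) := (C2.Kelvin.contDiff_flow (γ := γ) hV2 hK s).continuous
  have hCm : MeasurableSet C := hΦsc.measurable hBm
  have himage : Φ s '' C = B := by
    ext b
    constructor
    · rintro ⟨z, hz, rfl⟩; exact hz
    · intro hb; exact ⟨Φ (-s) b, by show Φ s (Φ (-s) b) ∈ B; rw [hΦinv b]; exact hb, hΦinv b⟩
  -- forward orbits of `C` on `[0, s]` are backward orbits of points of `B_n`: bounded by `Rstar`
  have hstay : ∀ z ∈ C, ∀ σ ∈ Icc 0 s, ‖Φ σ z‖ ≤ Rstar := by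
    intro z hz σ hσ
    have hb : Φ s z ∈ B := hz
    have hbn : ‖Φ s z‖ ≤ n := (mem_ball_zero_iff.1 hb.2).le
    have h1 : Φ σ z = Φ (-(s - σ)) (Φ s z) := by
      rw [← hflow_add]; congr 1; ring
    rw [h1]
    exact (norm_flow_neg_le_gronwallBound (γ := γ) hV1 hK hVlin hγ.le (Φ s z) (by linarith [hσ.2] : 0 ≤ s - σ)).trans
      (gronwallBound_mono hL0 hK₁ (norm_nonneg _) hbn (by linarith [hσ.1]))
  -- the cut-off field is divergence-free on `‖z‖ ≤ Rstar + 1`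
  have hdiv : ∀ z : EuclideanSpace ℝ (Fin 3), ‖z‖ ≤ Rstar + 1 → VectorCalculus.divergence V z = 0 := by
    intro z hz
    have hzball : z ∈ ball (0 : EuclideanSpace ℝ (Fin 3)) Rbig := mem_ball_zero_iff.2 (by rw [hRbig]; linarith)
    have hev : V =ᶠ[𝓝 z] U := by
      filter_upwards [isOpen_ball.mem_nhds hzball] with w hw using hVU w hw
    unfold VectorCalculus.divergence
    rw [hev.fderiv_eq]
    exact h.divFree z
  have hvol : volume (Φ s '' C) = ENNReal.ofReal (Real.exp (3 * γ * s)) * volume C :=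
    volume_image_flow_eq_exp_of_stay (γ := γ) hV2 hK hs hdiv hCm
      (fun z hz σ hσ => (hstay z hz σ hσ).trans (by linarith))
  -- `C ⊆ S` by the forward ratchet along the true orbit
  have hCS : C ⊆ S := by
    intro z hz
    have hb : Φ s z ∈ B := hz
    set Y : ℝ → EuclideanSpace ℝ (Fin 3) := fun σ => Φ σ z with hYdef
    have hY0 : Y 0 = z := by simp [hYdef, hΦ, ODE.evolutionMap_self]
    have hYU : ∀ σ ∈ Icc 0 s, HasDerivAt Y (selfSimilarTransport γ 0 U (Y σ)) σ := by
      intro σ hσ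
      have h1 := C2.Kelvin.hasDerivAt_flow (γ := γ) hV1 hK σ z
      rw [hWU _ (lt_of_le_of_lt (hstay z hz σ hσ) (by rw [hRbig]; linarith))] at h1
      exact h1
    have hrat := swirl_forward_orbit h hU hs hYU
    rw [hY0] at hrat
    -- `|Γ z| = |Γ (Φ s z)| e^{(1−2γ)s} > μ`
    have hexp : Real.exp (-((1 - 2 * γ) * s)) * Real.exp ((1 - 2 * γ) * s) = 1 := by
      rw [← Real.exp_add, neg_add_cancel, Real.exp_zero]
    have h2 : |swirl U z| = |swirl U (Y s)| * Real.exp ((1 - 2 * γ) * s) := by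
      rw [hrat, abs_mul, abs_of_pos (Real.exp_pos _), mul_assoc, hexp, mul_one]
    show μ < |swirl U z|
    rw [h2]
    have h3 := mul_lt_mul_of_pos_right hb.1 (Real.exp_pos ((1 - 2 * γ) * s))
    rwa [mul_assoc, hexp, mul_one] at h3
  calc volume B = volume (Φ s '' C) := by rw [himage]
    _ = ENNReal.ofReal (Real.exp (3 * γ * s)) * volume C := hvol
    _ ≤ ENNReal.ofReal (Real.exp (3 * γ * s)) * volume S := mul_le_mul' le_rfl (measure_mono hCS)

/-- **THE FAT TAIL**: `vol{|Γ| > μ} ≤ e^{3γs}·vol{|Γ| > μe^{(1−2γ)s}}` for `s ≥ 0` — the volume above a HIGH level is at least `e^{−3γs}` times the volume above the low one;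
in the class (`1−2γ = ργ`): `vol{|Γ| > λμ} ≥ λ^{−3/ρ}·vol{|Γ| > μ}`, `λ ≥ 1`. [cite: Chae2007CMPEuler, Thm 2.2 + Note added p. 6] -/
theorem swirl_fat_tail (h : IsSelfSimilarEulerProfile γ 0 U P) (hU : IsAxisymmetric U) (hγ : 0 < γ)
    {K₁ : ℝ} (hlin : ∀ y, ‖U y‖ ≤ K₁ * (1 + ‖y‖)) (μ : ℝ) {s : ℝ} (hs : 0 ≤ s) :
    volume {y : EuclideanSpace ℝ (Fin 3) | μ < |swirl U y|} ≤
      ENNReal.ofReal (Real.exp (3 * γ * s)) * volume {y : EuclideanSpace ℝ (Fin 3) | μ * Real.exp ((1 - 2 * γ) * s) < |swirl U y|} := by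
  have h1 := volume_superlevel_ratchet_backward h hU hγ hlin (μ * Real.exp ((1 - 2 * γ) * s)) hs
  have hexp : μ * Real.exp ((1 - 2 * γ) * s) * Real.exp (-((1 - 2 * γ) * s)) = μ := by
    rw [mul_assoc, ← Real.exp_add, add_neg_cancel, Real.exp_zero, mul_one]
  rwa [hexp] at h1

/-! ### The heavy-side Casimir kill -/

/-- **HEAVY-SIDE CASIMIR KILL**: `(U, P)` a `C²` self-similar Euler profile, `γ > 0`, `U` axisymmetric of linear growth, `∫⁻ |Γ|^p < ∞` for ONE exponent with `3γ < p(1−2γ)`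
(class: `p > 3/ρ`).  Then `U` is swirl-free: if `Γ(y₀) ≠ 0`, the open set `{|Γ| > |Γ(y₀)|/2}` has positive volume `v₀`, and the fat tail + Chebyshev give
`μ₀^p e^{p(1−2γ)s} v₀ ≤ e^{3γs}∫|Γ|^p` for all `s ≥ 0` — absurd. [cite: Chae2007CMPEuler, Thm 2.1–2.2 + Note added p. 6] -/
theorem hasNoSwirl_of_swirl_Lp_large (h : IsSelfSimilarEulerProfile γ 0 U P) (hU : IsAxisymmetric U) (hγ : 0 < γ)
    {K₁ : ℝ} (hlin : ∀ y, ‖U y‖ ≤ K₁ * (1 + ‖y‖)) {p : ℝ} (hp : 0 < p) (hpq : 3 * γ < p * (1 - 2 * γ))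
    (hI : ∫⁻ y, ENNReal.ofReal (|swirl U y| ^ p) < ⊤) : HasNoSwirl U := by
  have hUc : Continuous U := h.contDiff_velocity.continuous
  have hΓc : Continuous (swirl U) := (contDiff_swirl h.contDiff_velocity).continuous
  set I : ENNReal := ∫⁻ y, ENNReal.ofReal (|swirl U y| ^ p) with hIdef
  intro y₀
  by_contra hne
  set μ₀ : ℝ := |swirl U y₀| / 2 with hμ₀
  have hμ₀0 : 0 < μ₀ := by rw [hμ₀]; positivity
  set v₀ : ENNReal := volume {y : EuclideanSpace ℝ (Fin 3) | μ₀ < |swirl U y|} with hv₀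
  have hopen : IsOpen {y : EuclideanSpace ℝ (Fin 3) | μ₀ < |swirl U y|} := isOpen_lt continuous_const (continuous_abs.comp hΓc)
  have hv₀pos : 0 < v₀ := hopen.measure_pos volume ⟨y₀, by show μ₀ < |swirl U y₀|; rw [hμ₀]; linarith [abs_pos.2 hne]⟩
  set δ : ℝ := p * (1 - 2 * γ) - 3 * γ with hδ
  have hδ0 : 0 < δ := by rw [hδ]; linarith
  -- for every `s ≥ 0`: `ofReal(μ₀^p e^{δ s}) * v₀ ≤ I`
  have hbound : ∀ s : ℝ, 0 ≤ s → ENNReal.ofReal (μ₀ ^ p * Real.exp (δ * s)) * v₀ ≤ I := by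
    intro s hs
    set μs : ℝ := μ₀ * Real.exp ((1 - 2 * γ) * s) with hμs
    have hμs0 : 0 < μs := by rw [hμs]; positivity
    have hfat := swirl_fat_tail h hU hγ hlin μ₀ hs
    have hcheb := ofReal_rpow_mul_volume_superlevel_le hUc hp hμs0
    -- `ofReal(μs^p) * v₀ ≤ ofReal(μs^p) * ofReal(e^{3γs}) * vol{μs < |Γ|} ≤ ofReal(e^{3γs}) * I`
    have h1 : ENNReal.ofReal (μs ^ p) * v₀ ≤ ENNReal.ofReal (Real.exp (3 * γ * s)) * I :=
      calc ENNReal.ofReal (μs ^ p) * v₀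
          ≤ ENNReal.ofReal (μs ^ p) * (ENNReal.ofReal (Real.exp (3 * γ * s)) *
              volume {y : EuclideanSpace ℝ (Fin 3) | μs < |swirl U y|}) := mul_le_mul' le_rfl hfat
        _ = ENNReal.ofReal (Real.exp (3 * γ * s)) * (ENNReal.ofReal (μs ^ p) *
              volume {y : EuclideanSpace ℝ (Fin 3) | μs < |swirl U y|}) := by ring
        _ ≤ ENNReal.ofReal (Real.exp (3 * γ * s)) * I := mul_le_mul' le_rfl hcheb
    -- divide by `e^{3γs}`: `μs^p e^{−3γs} = μ₀^p e^{δ s}`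
    have h2 : μ₀ ^ p * Real.exp (δ * s) = Real.exp (-(3 * γ * s)) * μs ^ p := by
      rw [hμs, Real.mul_rpow hμ₀0.le (Real.exp_pos _).le, ← Real.exp_mul, hδ]
      rw [show Real.exp (-(3 * γ * s)) * (μ₀ ^ p * Real.exp ((1 - 2 * γ) * s * p)) =
        μ₀ ^ p * (Real.exp (-(3 * γ * s)) * Real.exp ((1 - 2 * γ) * s * p)) by ring, ← Real.exp_add]
      congr 1; congr 1; ring
    rw [h2, ENNReal.ofReal_mul (Real.exp_pos _).le, mul_assoc]
    calc ENNReal.ofReal (Real.exp (-(3 * γ * s))) * (ENNReal.ofReal (μs ^ p) * v₀)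
        ≤ ENNReal.ofReal (Real.exp (-(3 * γ * s))) * (ENNReal.ofReal (Real.exp (3 * γ * s)) * I) := mul_le_mul' le_rfl h1
      _ = I := by
          rw [← mul_assoc, ← ENNReal.ofReal_mul (Real.exp_pos _).le, ← Real.exp_add, neg_add_cancel, Real.exp_zero,
            ENNReal.ofReal_one, one_mul]
  -- `v₀` is finite (else the left side is `⊤`) and then zero
  have hv₀top : v₀ ≠ ⊤ := by
    intro htop
    have h1 := hbound 0 le_rfl
    rw [htop, ENNReal.mul_top (by rw [Ne, ENNReal.ofReal_eq_zero, not_le]; positivity)] at h1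
    exact absurd (le_antisymm le_top h1) hI.ne
  have hv₀r : 0 < v₀.toReal := ENNReal.toReal_pos hv₀pos.ne' hv₀top
  set a : ℝ := μ₀ ^ p * v₀.toReal with ha
  have ha0 : 0 < a := by rw [ha]; exact mul_pos (Real.rpow_pos_of_pos hμ₀0 _) hv₀r
  set s : ℝ := (I.toReal / a + 1) / δ with hsdef
  have hs0 : 0 ≤ s := by rw [hsdef]; positivity
  have hexp : I.toReal / a + 1 < Real.exp (δ * s) := by
    have h1 : δ * s = I.toReal / a + 1 := by rw [hsdef]; field_simp
    rw [h1]
    linarith [Real.add_one_le_exp (I.toReal / a + 1)]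
  have h3 : I.toReal < a * Real.exp (δ * s) := by
    have h4 : I.toReal < a * (I.toReal / a + 1) := by
      rw [mul_add, mul_div_cancel₀ _ ha0.ne', mul_one]; linarith
    exact h4.trans (mul_lt_mul_of_pos_left hexp ha0)
  have h5 := ENNReal.toReal_mono hI.ne (hbound s hs0)
  rw [ENNReal.toReal_mul, ENNReal.toReal_ofReal (by positivity)] at h5
  have h6 : μ₀ ^ p * Real.exp (δ * s) * v₀.toReal = a * Real.exp (δ * s) := by rw [ha]; ring
  linarith

/-- **EVERY FINITE SWIRL CASIMIR OFF THE BALANCED EXPONENT KILLS**: `∫⁻|Γ|^p < ∞` with `0 < p`, `p(1−2γ) ≠ 3γ` (class: `p ≠ 3/ρ`) ⇒ swirl-free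
(`…SwirlCasimir` below the balance, the fat tail above). [cite: Chae2007CMPEuler, Thm 2.1–2.2 + Note added p. 6] -/
theorem hasNoSwirl_of_swirl_Lp_ne (h : IsSelfSimilarEulerProfile γ 0 U P) (hU : IsAxisymmetric U) (hγ : 0 < γ)
    {K₁ : ℝ} (hlin : ∀ y, ‖U y‖ ≤ K₁ * (1 + ‖y‖)) {p : ℝ} (hp : 0 < p) (hpq : p * (1 - 2 * γ) ≠ 3 * γ)
    (hI : ∫⁻ y, ENNReal.ofReal (|swirl U y| ^ p) < ⊤) : HasNoSwirl U := by
  rcases lt_or_gt_of_ne hpq with hlt | hgt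
  · exact hasNoSwirl_of_swirl_Lp h hU hγ hlin hp hlt hI
  · exact hasNoSwirl_of_swirl_Lp_large h hU hγ hlin hp hgt hI

/-- In the class: `γ = 1/(2+ρ)`, `ρ > 0`: `p ≠ 3/ρ ⟹ p(1−2γ) ≠ 3γ`. [folklore] -/
theorem exponent_ne_of_ne {ρ p : ℝ} (hρ : 0 < ρ) (hp3 : p ≠ 3 / ρ) :
    p * (1 - 2 * (1 / (2 + ρ))) ≠ 3 * (1 / (2 + ρ)) := by
  have h2ρ : (0 : ℝ) < 2 + ρ := by linarith
  intro heq
  apply hp3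
  have e1 : p * (1 - 2 * (1 / (2 + ρ))) = p * ρ / (2 + ρ) := by field_simp; ring
  have e2 : 3 * (1 / (2 + ρ)) = 3 / (2 + ρ) := by ring
  rw [e1, e2] at heq
  have h3 : p * ρ = 3 := by
    have := congrArg (fun x => x * (2 + ρ)) heq
    simp only [div_mul_cancel₀ _ h2ρ.ne'] at this
    exact this
  field_simp
  linarith

end SwirlRatchet

/-! ### Member form -/

namespace SwirlRatchet

variable {u : ℝ → EuclideanSpace ℝ (Fin 3) → EuclideanSpace ℝ (Fin 3)} {p : ℝ → EuclideanSpace ℝ (Fin 3) → ℝ}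
  {H : ℝ → EuclideanSpace ℝ (Fin 3) → EuclideanSpace ℝ (Fin 3) →L[ℝ] EuclideanSpace ℝ (Fin 3)} {c : ℝ≥0}
  {V : EuclideanSpace ℝ (Fin 3) → EuclideanSpace ℝ (Fin 3)} {P : EuclideanSpace ℝ (Fin 3) → ℝ}

/-- **MEMBER FORM: AXISYMMETRIC `C²` PROFILE OF LINEAR GROWTH WITH ONE FINITE SWIRL CASIMIR OFF THE BALANCED EXPONENT ⇒ TRIVIAL.**  Crux binders verbatim (`0 < ρ ≤ ½`) +
exactly self-similar ansatz + `ContDiff ℝ 2 V` + `IsAxisymmetric V` + `‖V y‖ ≤ K₁(1+‖y‖)` + `∫⁻ ofReal(|swirl V|^q) < ⊤` for one `q > 0`, `q ≠ 3/ρ` ⇒ `u = 0` a.e.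
(supersedes `…_of_axisym_LpSwirl_C2`, which asked `q < 3/ρ`). [cite: Chae2007CMPEuler, Thm 2.1–2.2 + Note added p. 6] -/
theorem selfSimilar_ae_eq_zero_of_axisym_swirlCasimir_C2 {ρ : ℝ} (hρ : 0 < ρ) (hρ1 : ρ ≤ 1 / 2)
    (hsw : IsSuitableWeakSolutionOn (slab (EuclideanSpace ℝ (Fin 3)) (Iio 0) isOpen_Iio) 0 0 u p)
    (hH : HasWeakSpatialGradientOn (slab (EuclideanSpace ℝ (Fin 3)) (Iio 0) isOpen_Iio) u H)
    (hgauge : ∀ a : ℝ, 0 < a →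
      ENNReal.ofReal (a ^ (2 * ρ)) * cknA a (0 : ℝ × EuclideanSpace ℝ (Fin 3)) u +
          ENNReal.ofReal (a ^ ρ) * cknE a (0 : ℝ × EuclideanSpace ℝ (Fin 3)) H +
        ENNReal.ofReal (a ^ (2 * ρ)) * cknD a (0 : ℝ × EuclideanSpace ℝ (Fin 3)) p ≤ (c : ENNReal))
    (hu : ∀ τ : ℝ, τ < 0 → u τ = selfSimilarCollapse (1 / (2 + ρ)) 0 V τ)
    (hp : ∀ τ : ℝ, τ < 0 → p τ = selfSimilarCollapsePressure (1 / (2 + ρ)) 0 P τ)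
    (hV : ContDiff ℝ 2 V) (hax : IsAxisymmetric V)
    (hlin : ∃ K₁ : ℝ, ∀ y, ‖V y‖ ≤ K₁ * (1 + ‖y‖))
    (hLp : ∃ q : ℝ, 0 < q ∧ q ≠ 3 / ρ ∧ ∫⁻ y, ENNReal.ofReal (|swirl V y| ^ q) < ⊤) :
    uncurry u =ᵐ[volume.restrict (Iio (0 : ℝ) ×ˢ (univ : Set (EuclideanSpace ℝ (Fin 3))))] 0 := by
  obtain ⟨K₁, hK₁⟩ := hlin
  obtain ⟨q, hq, hq3, hI⟩ := hLp
  have hρ1' : ρ < 1 := by linarith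
  have h2ρ : (0 : ℝ) < 2 + ρ := by linarith
  have hγ : (0 : ℝ) < 1 / (2 + ρ) := one_div_pos.2 h2ρ
  -- a classical pressure of the profile (boilerplate of the lineage's member theorems)
  have hD : ∀ a : ℝ, 0 < a → ENNReal.ofReal (a ^ (2 * ρ)) *
      cknD a (0 : ℝ × EuclideanSpace ℝ (Fin 3)) p ≤ (c : ENNReal) :=
    fun a ha => le_trans le_add_self (hgauge a ha)
  have hpm : AEStronglyMeasurable (uncurry p)
      (volume.restrict (Iio (0 : ℝ) ×ˢ (univ : Set (EuclideanSpace ℝ (Fin 3))))) := by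
    have := hsw.distributional.2.2.1.aestronglyMeasurable
    simpa [slab] using this
  have hPm := aestronglyMeasurable_pressureProfile hpm hp
  have hDprof := profile_pressure_weight_of_gaugeD hρ hρ1' hpm hp hD
  have hP1 : LocallyIntegrable P volume :=
    EnergySaturation.locallyIntegrable_pressure_of_weight hρ1' hPm
      (ENNReal.mul_ne_top ENNReal.ofReal_ne_top ENNReal.coe_ne_top) hDprof
  obtain ⟨P', hprof⟩ := WeakToClassical.exists_isSelfSimilarEulerProfile_of_contDiff hsw.distributional hu hp hV hP1
  have hns : HasNoSwirl V := hasNoSwirl_of_swirl_Lp_ne hprof hax hγ hK₁ hq (exponent_ne_of_ne hρ hq3) hI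
  exact NeedleRace.selfSimilar_ae_eq_zero_of_axisymNoSwirlC2 hρ hρ1 hsw hH hgauge hu hp hV hax hns

end SwirlRatchet

end Summit.NavierStokesRegularity.NavierStokesRegularity.Theorems.PowerGaugeEulerLiouville

end
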